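import Summits.CriticalPhenomena.PercolationContinuityZ3.Theses.PercNearOneGluing
import Summits.CriticalPhenomena.PercolationContinuityZ3.Theorems.PercNearOneGluingAdditiveGluingOffClusterAssociation
import Summits.CriticalPhenomena.PercolationContinuityZ3.Theorems.PercNearOneGluingAdditiveGluingSpectatorEdgeBHK
import HarnessLib

/-!
# Crux `PercNearOneGluing.AdditiveGluing` (stmt-CriticalPhenomena-4576), line `tieline`: the auxiliary transfer
# (aux-β) of the Phi route — stub `stub_auxBeta_c14`

Support file (`--supports stmt-CriticalPhenomena-4576`, registered stub of line `tieline`, lead c14).  No definitions,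
no named facts, no sorries.

Weighted graph on `Fin n` (`μ = prodBernoulli w`, arbitrary edge weights), relays `u, v`, observer `o`, far end `b`,
spectator `c`; `D = {u ↮ v}`, `N = {c ↮ u} ∩ {c ↮ v}` ("`c` is free").

**aux-β.**  `μ(D ∩ N ∩ {o ↔ c}) · μ(D ∩ {v ↔ b} ∩ {c ↮ u}) ≤ μ(D ∩ N) · μ(D ∩ {v ↔ b} ∩ {o ↮ u})`, i.e.
`P_D(o ∉ C_u | b ∈ C_v) ≥ P_D(o ↔ c | c free) · P_D(c ∉ C_u | b ∈ C_v)`.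

Proof.  Put `F = {u ↮ v} ∩ {u ↮ c} = {u ↮ {v, c}}` and, for vertices `x, y`, `E_xy = {x ↔ y} ∩ {x ↮ u}` (the
`u`-free connection events).  By the off-cluster association engine `OffCluster.sFreeConn_posAssoc` (van den
Berg–Häggström–Kahn, Thm. 1.5 with Thm. 1.3, `s = u`, `X = {v, c}`), given `F` any two `u`-free connection events are
positively correlated:  (i) `μ(F ∩ E_vb) μ(F ∩ E_co) ≤ μ(F) μ(F ∩ E_vb ∩ E_co)`;  (ii) `μ(F ∩ E_co) μ(F ∩ E_cv) ≤
μ(F) μ(F ∩ E_co ∩ E_cv)`.  On `F`, `E_cv = {c ↔ v}`, so (ii) says that `E_co` and `{c ↮ v}` are negatively correlated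
given `F`:  `μ(F) μ(F ∩ E_co ∩ {c ↮ v}) ≤ μ(F ∩ E_co) μ(F ∩ {c ↮ v})`.  Hence
`μ(F) · μ(F ∩ E_co ∩ {c ↮ v}) μ(F ∩ E_vb) ≤ μ(F ∩ {c ↮ v}) · μ(F ∩ E_vb) μ(F ∩ E_co) ≤ μ(F) · μ(F ∩ {c ↮ v})
μ(F ∩ E_vb ∩ E_co)` by (i), and cancelling `μ(F)` (if `μ(F) = 0` then `μ(F ∩ E_vb) = 0` and both sides vanish)
`μ(F ∩ E_co ∩ {c ↮ v}) μ(F ∩ E_vb) ≤ μ(F ∩ {c ↮ v}) μ(F ∩ E_vb ∩ E_co)`.  Finally `F ∩ E_co ∩ {c ↮ v} = D ∩ N ∩ {o ↔ c}`,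
`F ∩ E_vb = D ∩ {v ↔ b} ∩ {c ↮ u}`, `F ∩ {c ↮ v} = D ∩ N`, and `F ∩ E_vb ∩ E_co ⊆ D ∩ {v ↔ b} ∩ {o ↮ u}`
(`o ↔ c ↮ u`).  The degenerate cases `u = v`, `u = c` read `0 ≤ 0` (`{u ↮ u} = ∅`, `SpectatorEdgeBHK.compl_openConn_self`).
[cite: VandenbergHaggstromKahn2005, Thm. 1.3 (p. 6), Thm. 1.5 (pp. 7–8) — corollary]
-/

namespace Summit.CriticalPhenomena.PercolationContinuityZ3.Cruxes.AdditiveGluing.TieLine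

open MeasureTheory Set Literature.Probability.LatticeModels Literature.Probability.Percolation

noncomputable section

namespace AuxBeta

variable {V : Type*}

/-! ### Set identities (`F = {u ↮ {v, c}}`, `E_xy = {x ↔ y} ∩ {x ↮ u}`, `D = {u ↮ v}`, `N = {c ↮ u} ∩ {c ↮ v}`) -/

/-- Membership in `F = {u ↮ {v, c}}`: `u ↮ v` and `u ↮ c`. [folklore] -/
theorem mem_F_iff (u v c : V) (ω : BondConfig V) :
    ω ∈ ({ω : BondConfig V | ∀ x ∈ ({v, c} : Set V), ¬ (openGraph ω).Reachable u x}) ↔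
      ¬ (openGraph ω).Reachable u v ∧ ¬ (openGraph ω).Reachable u c := by
  simp only [mem_setOf_eq, mem_insert_iff, mem_singleton_iff, forall_eq_or_imp, forall_eq]

/-- `F ∩ E_vb = D ∩ {v ↔ b} ∩ {c ↮ u}` (on `{u ↮ v}` the side condition `v ↮ u` of `E_vb` is automatic). [folklore] -/
theorem F_inter_Evb (b u v c : V) :
    ({ω : BondConfig V | ∀ x ∈ ({v, c} : Set V), ¬ (openGraph ω).Reachable u x} ∩
        (openConn v b ∩ (openConn v u)ᶜ) : Set (BondConfig V)) =
      (openConn u v)ᶜ ∩ openConn v b ∩ (openConn c u)ᶜ := by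
  ext ω
  rw [mem_inter_iff, mem_F_iff]
  simp only [mem_inter_iff, mem_compl_iff, openConn, mem_setOf_eq]
  constructor
  · rintro ⟨⟨huv, huc⟩, hvb, _⟩
    exact ⟨⟨huv, hvb⟩, fun h => huc h.symm⟩
  · rintro ⟨⟨huv, hvb⟩, hcu⟩
    exact ⟨⟨huv, fun h => hcu h.symm⟩, hvb, fun h => huv h.symm⟩

/-- `F ∩ {c ↮ v} = D ∩ N`. [folklore] -/
theorem F_inter_notConn (u v c : V) :
    ({ω : BondConfig V | ∀ x ∈ ({v, c} : Set V), ¬ (openGraph ω).Reachable u x} ∩ (openConn c v)ᶜ :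
        Set (BondConfig V)) =
      (openConn u v)ᶜ ∩ ((openConn c u)ᶜ ∩ (openConn c v)ᶜ) := by
  ext ω
  rw [mem_inter_iff, mem_F_iff]
  simp only [mem_inter_iff, mem_compl_iff, openConn, mem_setOf_eq]
  constructor
  · rintro ⟨⟨huv, huc⟩, hcv⟩
    exact ⟨huv, fun h => huc h.symm, hcv⟩
  · rintro ⟨huv, hcu, hcv⟩
    exact ⟨⟨huv, fun h => hcu h.symm⟩, hcv⟩

/-- `F ∩ E_co ∩ {c ↮ v} = D ∩ N ∩ {o ↔ c}`. [folklore] -/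
theorem F_inter_Eco_inter_notConn (o u v c : V) :
    ({ω : BondConfig V | ∀ x ∈ ({v, c} : Set V), ¬ (openGraph ω).Reachable u x} ∩
        (openConn c o ∩ (openConn c u)ᶜ) ∩ (openConn c v)ᶜ : Set (BondConfig V)) =
      (openConn u v)ᶜ ∩ ((openConn c u)ᶜ ∩ (openConn c v)ᶜ) ∩ openConn o c := by
  ext ω
  rw [mem_inter_iff, mem_inter_iff, mem_F_iff]
  simp only [mem_inter_iff, mem_compl_iff, openConn, mem_setOf_eq]
  constructor
  · rintro ⟨⟨⟨huv, _⟩, hco, hcu⟩, hcv⟩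
    exact ⟨⟨huv, hcu, hcv⟩, hco.symm⟩
  · rintro ⟨⟨huv, hcu, hcv⟩, hoc⟩
    exact ⟨⟨⟨huv, fun h => hcu h.symm⟩, hoc.symm, hcu⟩, hcv⟩

/-- `F ∩ E_co ∩ {c ↔ v} = F ∩ (E_co ∩ E_cv)`. [folklore] -/
theorem F_inter_Eco_inter_conn (o u v c : V) :
    ({ω : BondConfig V | ∀ x ∈ ({v, c} : Set V), ¬ (openGraph ω).Reachable u x} ∩
        (openConn c o ∩ (openConn c u)ᶜ) ∩ openConn c v : Set (BondConfig V)) =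
      {ω : BondConfig V | ∀ x ∈ ({v, c} : Set V), ¬ (openGraph ω).Reachable u x} ∩
        ((openConn c o ∩ (openConn c u)ᶜ) ∩ (openConn c v ∩ (openConn c u)ᶜ)) := by
  ext ω
  simp only [mem_inter_iff, mem_compl_iff]
  constructor
  · rintro ⟨⟨hF, hco, hcu⟩, hcv⟩
    exact ⟨hF, ⟨hco, hcu⟩, hcv, hcu⟩
  · rintro ⟨hF, ⟨hco, hcu⟩, hcv, _⟩
    exact ⟨⟨hF, hco, hcu⟩, hcv⟩

/-- `F ∩ {c ↔ v} = F ∩ E_cv` (on `F` the side condition `c ↮ u` is automatic). [folklore] -/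
theorem F_inter_conn (u v c : V) :
    ({ω : BondConfig V | ∀ x ∈ ({v, c} : Set V), ¬ (openGraph ω).Reachable u x} ∩ openConn c v :
        Set (BondConfig V)) =
      {ω : BondConfig V | ∀ x ∈ ({v, c} : Set V), ¬ (openGraph ω).Reachable u x} ∩
        (openConn c v ∩ (openConn c u)ᶜ) := by
  ext ω
  simp only [mem_inter_iff, mem_compl_iff]
  constructor
  · rintro ⟨hF, hcv⟩
    exact ⟨hF, hcv, fun h => ((mem_F_iff u v c ω).1 hF).2 h.symm⟩
  · rintro ⟨hF, hcv, _⟩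
    exact ⟨hF, hcv⟩

/-- `F ∩ E_vb ∩ E_co ⊆ D ∩ {v ↔ b} ∩ {o ↮ u}` (`o ↔ c` and `c ↮ u` give `o ↮ u`). [folklore] -/
theorem F_inter_Evb_inter_Eco_subset (o b u v c : V) :
    ({ω : BondConfig V | ∀ x ∈ ({v, c} : Set V), ¬ (openGraph ω).Reachable u x} ∩
        ((openConn v b ∩ (openConn v u)ᶜ) ∩ (openConn c o ∩ (openConn c u)ᶜ)) : Set (BondConfig V)) ⊆
      (openConn u v)ᶜ ∩ openConn v b ∩ (openConn o u)ᶜ := by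
  rintro ω ⟨hF, ⟨hvb, -⟩, hco, hcu⟩
  simp only [mem_inter_iff, mem_compl_iff, openConn, mem_setOf_eq] at hvb hco hcu ⊢
  exact ⟨⟨((mem_F_iff u v c ω).1 hF).1, hvb⟩, fun hou => hcu (hco.trans hou)⟩

/-! ### The transfer in engine coordinates -/

variable [Fintype V]

/-- **aux-β in engine coordinates.**  For `u ∉ {v, c}`, `F = {u ↮ {v, c}}`, `E_xy = {x ↔ y} ∩ {x ↮ u}`:
`μ(F ∩ E_co ∩ {c ↮ v}) · μ(F ∩ E_vb) ≤ μ(F ∩ {c ↮ v}) · μ(F ∩ (E_vb ∩ E_co))` — two applications of the positive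
correlation of `u`-free connection events given `F` (`OffCluster.sFreeConn_posAssoc`, for `(E_vb, E_co)` and for
`(E_co, E_cv)`), complements inside `F`, and cancellation of `μ(F)`.
[cite: VandenbergHaggstromKahn2005, Thm. 1.3 (p. 6), Thm. 1.5 (pp. 7–8) — corollary] -/
theorem transfer (w : Sym2 V → unitInterval) {u v c : V} (hs : u ∉ ({v, c} : Set V)) (o b : V) :
    (prodBernoulli w).real ({ω : BondConfig V | ∀ x ∈ ({v, c} : Set V), ¬ (openGraph ω).Reachable u x} ∩
          (openConn c o ∩ (openConn c u)ᶜ) ∩ (openConn c v)ᶜ) *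
      (prodBernoulli w).real ({ω : BondConfig V | ∀ x ∈ ({v, c} : Set V), ¬ (openGraph ω).Reachable u x} ∩
          (openConn v b ∩ (openConn v u)ᶜ)) ≤
    (prodBernoulli w).real ({ω : BondConfig V | ∀ x ∈ ({v, c} : Set V), ¬ (openGraph ω).Reachable u x} ∩
          (openConn c v)ᶜ) *
      (prodBernoulli w).real ({ω : BondConfig V | ∀ x ∈ ({v, c} : Set V), ¬ (openGraph ω).Reachable u x} ∩
          ((openConn v b ∩ (openConn v u)ᶜ) ∩ (openConn c o ∩ (openConn c u)ᶜ))) := by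
  set F : Set (BondConfig V) := {ω : BondConfig V | ∀ x ∈ ({v, c} : Set V), ¬ (openGraph ω).Reachable u x} with hF
  -- (i) `E_vb`, `E_co` positively correlated given `F`; (ii) `E_co`, `E_cv` positively correlated given `F`
  have key1 := OffCluster.sFreeConn_posAssoc w u ({v, c} : Set V) hs v b c o
  have key2 := OffCluster.sFreeConn_posAssoc w u ({v, c} : Set V) hs c o c v
  rw [← hF] at key1 key2
  -- complements inside `F` and inside `F ∩ E_co`
  have hcv : MeasurableSet (openConn c v : Set (BondConfig V)) := MeasurableSet.of_discrete
  have hA := measureReal_inter_add_sdiff (μ := prodBernoulli w) (s := F) hcv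
  have hP := measureReal_inter_add_sdiff (μ := prodBernoulli w) (s := F ∩ (openConn c o ∩ (openConn c u)ᶜ)) hcv
  rw [Set.sdiff_eq, F_inter_conn u v c] at hA
  rw [Set.sdiff_eq, F_inter_Eco_inter_conn o u v c] at hP
  -- bookkeeping: all quantities are nonnegative reals
  have h0F : 0 ≤ (prodBernoulli w).real F := measureReal_nonneg
  have h0L : 0 ≤ (prodBernoulli w).real (F ∩ (openConn c v)ᶜ) := measureReal_nonneg
  have h0B : 0 ≤ (prodBernoulli w).real (F ∩ (openConn v b ∩ (openConn v u)ᶜ)) := measureReal_nonneg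
  have h0P : 0 ≤ (prodBernoulli w).real (F ∩ (openConn c o ∩ (openConn c u)ᶜ)) := measureReal_nonneg
  -- `μ(F) · LHS ≤ μ(F) · RHS`
  have key : (prodBernoulli w).real F *
      ((prodBernoulli w).real (F ∩ (openConn c o ∩ (openConn c u)ᶜ) ∩ (openConn c v)ᶜ) *
        (prodBernoulli w).real (F ∩ (openConn v b ∩ (openConn v u)ᶜ))) ≤
      (prodBernoulli w).real F *
      ((prodBernoulli w).real (F ∩ (openConn c v)ᶜ) *
        (prodBernoulli w).real (F ∩ ((openConn v b ∩ (openConn v u)ᶜ) ∩ (openConn c o ∩ (openConn c u)ᶜ)))) := by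
    calc (prodBernoulli w).real F *
          ((prodBernoulli w).real (F ∩ (openConn c o ∩ (openConn c u)ᶜ) ∩ (openConn c v)ᶜ) *
            (prodBernoulli w).real (F ∩ (openConn v b ∩ (openConn v u)ᶜ)))
        = ((prodBernoulli w).real F * (prodBernoulli w).real (F ∩ (openConn c o ∩ (openConn c u)ᶜ)) -
            (prodBernoulli w).real F *
              (prodBernoulli w).real (F ∩ ((openConn c o ∩ (openConn c u)ᶜ) ∩ (openConn c v ∩ (openConn c u)ᶜ)))) *
            (prodBernoulli w).real (F ∩ (openConn v b ∩ (openConn v u)ᶜ)) := by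
          rw [← hP]; ring
      _ ≤ ((prodBernoulli w).real F * (prodBernoulli w).real (F ∩ (openConn c o ∩ (openConn c u)ᶜ)) -
            (prodBernoulli w).real (F ∩ (openConn c o ∩ (openConn c u)ᶜ)) *
              (prodBernoulli w).real (F ∩ (openConn c v ∩ (openConn c u)ᶜ))) *
            (prodBernoulli w).real (F ∩ (openConn v b ∩ (openConn v u)ᶜ)) :=
          mul_le_mul_of_nonneg_right (sub_le_sub_left key2 _) h0B
      _ = (prodBernoulli w).real (F ∩ (openConn c v)ᶜ) *
            ((prodBernoulli w).real (F ∩ (openConn v b ∩ (openConn v u)ᶜ)) *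
              (prodBernoulli w).real (F ∩ (openConn c o ∩ (openConn c u)ᶜ))) := by
          rw [← hA]; ring
      _ ≤ (prodBernoulli w).real (F ∩ (openConn c v)ᶜ) * ((prodBernoulli w).real F *
            (prodBernoulli w).real (F ∩ ((openConn v b ∩ (openConn v u)ᶜ) ∩ (openConn c o ∩ (openConn c u)ᶜ)))) :=
          mul_le_mul_of_nonneg_left key1 h0L
      _ = _ := by ring
  rcases h0F.eq_or_lt with hF0 | hFpos
  · -- `μ(F) = 0`: then `μ(F ∩ E_vb) = 0` and both sides vanish
    have hB0 : (prodBernoulli w).real (F ∩ (openConn v b ∩ (openConn v u)ᶜ)) = 0 :=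
      le_antisymm (hF0 ▸ measureReal_mono Set.inter_subset_left) h0B
    rw [hB0, mul_zero]
    exact mul_nonneg h0L measureReal_nonneg
  · exact le_of_mul_le_mul_left key hFpos

end AuxBeta

open Summit.CriticalPhenomena.PercolationContinuityZ3.Theorems.SpectatorEdgeBHK (compl_openConn_self) in
open AuxBeta in
/-- **aux-β (auxiliary transfer of the Phi route)** (line `tieline`, crux `AdditiveGluing`; lead c14, stub
`stub_auxBeta_c14`): with `D = {u ↮ v}`, `N = {c ↮ u} ∩ {c ↮ v}`,
`μ(D ∩ N ∩ {o ↔ c}) · μ(D ∩ {v ↔ b} ∩ {c ↮ u}) ≤ μ(D ∩ N) · μ(D ∩ {v ↔ b} ∩ {o ↮ u})`, i.e.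
`P_D(o ∉ C_u | b ∈ C_v) ≥ P_D(o ↔ c | c free) · P_D(c ∉ C_u | b ∈ C_v)`.  Corollary of van den Berg–Häggström–Kahn
conditional association in the off-cluster form (`OffCluster.sFreeConn_posAssoc` with `s = u`, `X = {v, c}`): given
`F = {u ↮ {v, c}}`, `{v ↔ b off C̄_u}` and `{c ↔ o off C̄_u}` are positively correlated, `{c ↔ o off C̄_u}` and
`{c ↮ v}` negatively; multiply, cancel `μ(F)`, and read the four events back in terms of `D`, `N`
(`AuxBeta.transfer` and the set identities of `AuxBeta`). [cite: VandenbergHaggstromKahn2005, Thm. 1.3 (p. 6), Thm. 1.5 (pp. 7–8) — corollary] -/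
theorem stub_auxBeta_c14 : ∀ (n : ℕ) (w : Sym2 (Fin n) → unitInterval) (o b u v c : Fin n), (Literature.Probability.LatticeModels.prodBernoulli w).real ((Literature.Probability.Percolation.openConn u v)ᶜ ∩ ((Literature.Probability.Percolation.openConn c u)ᶜ ∩ (Literature.Probability.Percolation.openConn c v)ᶜ) ∩ Literature.Probability.Percolation.openConn o c : Set (Literature.Probability.Percolation.BondConfig (Fin n))) * (Literature.Probability.LatticeModels.prodBernoulli w).real ((Literature.Probability.Percolation.openConn u v)ᶜ ∩ Literature.Probability.Percolation.openConn v b ∩ (Literature.Probability.Percolation.openConn c u)ᶜ : Set (Literature.Probability.Percolation.BondConfig (Fin n))) ≤ (Literature.Probability.LatticeModels.prodBernoulli w).real ((Literature.Probability.Percolation.openConn u v)ᶜ ∩ ((Literature.Probability.Percolation.openConn c u)ᶜ ∩ (Literature.Probability.Percolation.openConn c v)ᶜ) : Set (Literature.Probability.Percolation.BondConfig (Fin n))) * (Literature.Probability.LatticeModels.prodBernoulli w).real ((Literature.Probability.Percolation.openConn u v)ᶜ ∩ Literature.Probability.Percolation.openConn v b ∩ (Literature.Probability.Percolation.openConn o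 u)ᶜ : Set (Literature.Probability.Percolation.BondConfig (Fin n))) := by
  intro n w o b u v c
  by_cases hs : u ∈ ({v, c} : Set (Fin n))
  · -- degenerate cases `u = v` (`D = ∅`) and `u = c` (`N = ∅`): both sides vanish
    rcases hs with rfl | huc
    · simp only [compl_openConn_self, Set.empty_inter, measureReal_empty, zero_mul, le_refl]
    · rw [Set.mem_singleton_iff] at huc
      subst huc
      simp only [compl_openConn_self, Set.empty_inter, Set.inter_empty, measureReal_empty, zero_mul, le_refl]
  · -- the engine transfer, read back along the set identities
    have key := transfer w hs o b
    rw [F_inter_Eco_inter_notConn o u v c, F_inter_Evb b u v c, F_inter_notConn u v c] at key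
    exact key.trans (mul_le_mul_of_nonneg_left
      (measureReal_mono (F_inter_Evb_inter_Eco_subset o b u v c)) measureReal_nonneg)

end

end Summit.CriticalPhenomena.PercolationContinuityZ3.Cruxes.AdditiveGluing.TieLine
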